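import Literature.Analysis.FluidPDE.FiniteFourierModeEulerLoop

/-!
# Kishimoto–Yoneda, §4 Lemma 4.6 / Prop. 4.7: transport around a closed chain of any length

Support file for `FiniteFourierModeEuler` (N. Kishimoto, T. Yoneda, J. Math. Fluid Mech. 24
(2022) 74 = arXiv:2110.08039). The proofs of Prop. 4.4 (iv) and Prop. 4.7 transport the
coefficient vector `u_{n₁}` along a closed chain `n₁ → n₂ → ⋯ → n_p → n₁` of pairwise
non-interacting frequencies (Prop. 2.2) and use that the composed rotation `𝓡₁` (Lemma 4.6) is
not a rotation by a multiple of `π`. Here we prove the ALGEBRAIC half of this for chains of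
arbitrary length `m`, with NO assumption on the types (ii)/(iii) of the sides and no equal-norm
assumption (so it serves both for Prop. 4.4 (iv), where the vectors are "degenerate", and for
Prop. 4.7):

* `frameFactor p v q = (p × v)·(v × q) + i [p,v,q] |v|` is the (unnormalised) complex number
  `|p × v| |v × q| e^{iψ}` of the elementary rotation by which Lemma 4.6 passes at the vertex `v`
  from the frame of the plane `(p, v)` to the frame of the plane `(v, q)` (`frame_change`).
* `circ_out_eq` (one vertex): in the "circular" coordinates `x|v| ± i y` of a frame vector
  `x (k × v) + y k` the frame change is MULTIPLICATION by `conj(frameFactor)` resp. `frameFactor`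
  (divided by `|v × q|²`).
* `circ_transport` (one side, Prop. 2.2): non-interaction transports both circular coordinates by
  the same non-zero factor.
* `dot_self_eq_zero_or_conj_prod_frameFactor_eq` (**closed chain of length `m`**): for an
  `m`-periodic chain of non-zero divergence-free vectors at frequencies with consecutive pairs
  independent and non-interacting, either `u₀ · u₀ = 0` (so `u₀` is `BV^±`,
  `exists_isBV_of_dot_self_eq_zero`) or the product `W` of the `m` frame factors is REAL
  (`conj W = W`), i.e. the total rotation angle `Σ ψ_v` of `𝓡₁` lies in `πℤ`.

## References

* [KishimotoYoneda2022] N. Kishimoto, T. Yoneda, J. Math. Fluid Mech. 24 (2022) 74 =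
  arXiv:2110.08039, §4 Lemma 4.6 (proof: "the composition operator `𝓡₁` restricted to
  `T_{ω₁}𝕊²` is the rotation by `2 Σ θ_j`"), Prop. 4.4 (iv), Prop. 4.7.
-/

noncomputable section

open Matrix Complex

namespace Literature.Analysis.FluidPDE

namespace KY

/-! ### The frame factor of one vertex -/

/-- The complex frame factor at the vertex `v` between the planes `(p, v)` and `(v, q)`:
`(p × v)·(v × q) + i [p, v, q] |v| = |p × v| |v × q| e^{iψ_v}` where `ψ_v` is the angle of the
elementary rotation of Lemma 4.6 at `v`. [cite: KishimotoYoneda2022, §4 Lemma 4.6 (proof)] -/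
def frameFactor (p v q : Fin 3 → ℝ) : ℂ :=
  (((p ⨯₃ v) ⬝ᵥ (v ⨯₃ q) : ℝ) : ℂ) + I * ((p ⬝ᵥ (v ⨯₃ q) : ℝ) : ℂ) * (Real.sqrt (v ⬝ᵥ v) : ℂ)

/-- The conjugate frame factor. [cite: KishimotoYoneda2022, §4 Lemma 4.6 (proof)] -/
theorem conj_frameFactor (p v q : Fin 3 → ℝ) :
    (starRingEnd ℂ) (frameFactor p v q)
      = (((p ⨯₃ v) ⬝ᵥ (v ⨯₃ q) : ℝ) : ℂ)
          - I * ((p ⬝ᵥ (v ⨯₃ q) : ℝ) : ℂ) * (Real.sqrt (v ⬝ᵥ v) : ℂ) := by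
  unfold frameFactor
  simp only [map_add, map_mul, Complex.conj_ofReal, Complex.conj_I]
  ring

/-- `|frameFactor|² = |p × v|² |v × q|²` (Lagrange's identity `c² + |v|²τ² = |k_in|²|k_out|²`).
[cite: KishimotoYoneda2022, §4 Lemma 4.6 (proof)] -/
theorem frameFactor_mul_conj (p v q : Fin 3 → ℝ) :
    frameFactor p v q * (starRingEnd ℂ) (frameFactor p v q)
      = ((((p ⨯₃ v) ⬝ᵥ (p ⨯₃ v)) * ((v ⨯₃ q) ⬝ᵥ (v ⨯₃ q)) : ℝ) : ℂ) := by
  rw [conj_frameFactor]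
  unfold frameFactor
  have hρ : (0 : ℝ) ≤ v ⬝ᵥ v := by
    rw [real_dot_eq]; nlinarith [sq_nonneg (v 0), sq_nonneg (v 1), sq_nonneg (v 2)]
  have hs : ((Real.sqrt (v ⬝ᵥ v) : ℂ)) ^ 2 = ((v ⬝ᵥ v : ℝ) : ℂ) := by
    rw [← Complex.ofReal_pow, Real.sq_sqrt hρ]
  have key : ((((p ⨯₃ v) ⬝ᵥ (p ⨯₃ v)) * ((v ⨯₃ q) ⬝ᵥ (v ⨯₃ q)) : ℝ) : ℂ)
      = (((p ⨯₃ v) ⬝ᵥ (v ⨯₃ q) : ℝ) : ℂ) ^ 2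
          + ((p ⬝ᵥ (v ⨯₃ q) : ℝ) : ℂ) ^ 2 * ((v ⬝ᵥ v : ℝ) : ℂ) := by
    norm_cast
    simp only [real_dot_eq, cross_apply, Matrix.cons_val_zero, Matrix.cons_val_one,
      Matrix.head_cons, Matrix.cons_val_two, Matrix.tail_cons]
    ring
  rw [key]
  linear_combination (-(((p ⬝ᵥ (v ⨯₃ q) : ℝ) : ℂ)) ^ 2 * (Real.sqrt (v ⬝ᵥ v) : ℂ) ^ 2) * Complex.I_sq
    + (((p ⬝ᵥ (v ⨯₃ q) : ℝ) : ℂ)) ^ 2 * hs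

/-- The frame factor vanishes only if one of the two frames degenerates.
[cite: KishimotoYoneda2022, §4 Lemma 4.6 (proof)] -/
theorem frameFactor_ne_zero {p v q : Fin 3 → ℝ} (hpv : p ⨯₃ v ≠ 0) (hvq : v ⨯₃ q ≠ 0) :
    frameFactor p v q ≠ 0 := by
  intro h
  have := frameFactor_mul_conj p v q
  rw [h, zero_mul] at this
  have h2 : ((p ⨯₃ v) ⬝ᵥ (p ⨯₃ v)) * ((v ⨯₃ q) ⬝ᵥ (v ⨯₃ q)) = 0 := by exact_mod_cast this.symm
  rcases mul_eq_zero.1 h2 with h3 | h3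
  · exact real_dot_self_ne_zero hpv h3
  · exact real_dot_self_ne_zero hvq h3

/-! ### One vertex: the frame change multiplies the circular coordinates -/

/-- **Lemma 4.6, one vertex, circular form.** If the same vector `u ⊥ v` is written in the frame of
the plane `(p, v)` (`k = p × v`) as `x (k × v) + y k` and in the frame of the plane `(v, q)`
(`k' = v × q`) as `x' (k' × v) + y' k'`, then
`|k'|² (x'|v| + i y') = conj(F) (x|v| + i y)` and `|k'|² (x'|v| - i y') = F (x|v| - i y)` with
`F = frameFactor p v q`. [cite: KishimotoYoneda2022, §4 Lemma 4.6 (proof)] -/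
theorem circ_out_eq {p v q : Fin 3 → ℝ} (hvq : v ⨯₃ q ≠ 0) {u : Fin 3 → ℂ} {x y x' y' : ℂ}
    (hin : u = x • cplx ((p ⨯₃ v) ⨯₃ v) + y • cplx (p ⨯₃ v))
    (hout : u = x' • cplx ((v ⨯₃ q) ⨯₃ v) + y' • cplx (v ⨯₃ q)) :
    ((((v ⨯₃ q) ⬝ᵥ (v ⨯₃ q)) : ℝ) : ℂ) * (x' * (Real.sqrt (v ⬝ᵥ v) : ℂ) + I * y')
        = (starRingEnd ℂ) (frameFactor p v q) * (x * (Real.sqrt (v ⬝ᵥ v) : ℂ) + I * y)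
      ∧ ((((v ⨯₃ q) ⬝ᵥ (v ⨯₃ q)) : ℝ) : ℂ) * (x' * (Real.sqrt (v ⬝ᵥ v) : ℂ) - I * y')
        = frameFactor p v q * (x * (Real.sqrt (v ⬝ᵥ v) : ℂ) - I * y) := by
  have hfc := frame_change p v q x y
  rw [← hin, hout, smul_add, smul_smul, smul_smul] at hfc
  obtain ⟨h1, h2⟩ := (frame_eq_iff₁ hvq _ _ _ _).1 hfc
  have hρ : (0 : ℝ) ≤ v ⬝ᵥ v := by
    rw [real_dot_eq]; nlinarith [sq_nonneg (v 0), sq_nonneg (v 1), sq_nonneg (v 2)]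
  have hs : ((Real.sqrt (v ⬝ᵥ v) : ℂ)) ^ 2 = ((v ⬝ᵥ v : ℝ) : ℂ) := by
    rw [← Complex.ofReal_pow, Real.sq_sqrt hρ]
  rw [conj_frameFactor]
  unfold frameFactor
  constructor
  · linear_combination (Real.sqrt (v ⬝ᵥ v) : ℂ) * h1 + I * h2
      + I * ((p ⬝ᵥ (v ⨯₃ q) : ℝ) : ℂ) * x * hs
      + ((p ⬝ᵥ (v ⨯₃ q) : ℝ) : ℂ) * (Real.sqrt (v ⬝ᵥ v) : ℂ) * y * Complex.I_sq
  · linear_combination (Real.sqrt (v ⬝ᵥ v) : ℂ) * h1 - I * h2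
      - I * ((p ⬝ᵥ (v ⨯₃ q) : ℝ) : ℂ) * x * hs
      + ((p ⬝ᵥ (v ⨯₃ q) : ℝ) : ℂ) * (Real.sqrt (v ⬝ᵥ v) : ℂ) * y * Complex.I_sq

/-! ### One side: non-interaction transports the circular coordinates (Prop. 2.2) -/

/-- **Prop. 2.2 in circular form.** Along a side `(v, w)` (`k = v × w ≠ 0`) with non-zero
non-interacting vectors `u_v = x (k × v) + y k`, `u_w = x' (k × w) + y' k`, both circular
coordinates are multiplied by the same non-zero factor:
`x'|w| ± i y' = γ (x|v| ± i y)`. (Case (ii): `x = x' = 0`; case (iii): `|v| = |w|`.)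
[cite: KishimotoYoneda2022, §2 Prop. 2.2 and Remark 2.4] -/
theorem circ_transport {v w : Fin 3 → ℝ} (hk : v ⨯₃ w ≠ 0) {uv uw : Fin 3 → ℂ} {x y x' y' : ℂ}
    (huv : uv = x • cplx ((v ⨯₃ w) ⨯₃ v) + y • cplx (v ⨯₃ w))
    (huw : uw = x' • cplx ((v ⨯₃ w) ⨯₃ w) + y' • cplx (v ⨯₃ w))
    (hnev : uv ≠ 0) (hnew : uw ≠ 0) (h : NonInteracting v w uv uw) :
    ∃ γ : ℂ, γ ≠ 0 ∧
      x' * (Real.sqrt (w ⬝ᵥ w) : ℂ) + I * y' = γ * (x * (Real.sqrt (v ⬝ᵥ v) : ℂ) + I * y) ∧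
      x' * (Real.sqrt (w ⬝ᵥ w) : ℂ) - I * y' = γ * (x * (Real.sqrt (v ⬝ᵥ v) : ℂ) - I * y) := by
  obtain ⟨⟨γ, hγ, hx, hy⟩, hnorm⟩ := nonInteracting_transport hk huv huw hnev hnew h
  refine ⟨γ, hγ, ?_, ?_⟩
  · by_cases hx0 : x = 0
    · rw [hx, hy, hx0]; ring
    · rw [hx, hy, hnorm hx0]; ring
  · by_cases hx0 : x = 0
    · rw [hx, hy, hx0]; ring
    · rw [hx, hy, hnorm hx0]; ring

/-! ### Closed chains -/

section Chain

variable {m : ℕ} {v : ℕ → Fin 3 → ℝ} {u : ℕ → Fin 3 → ℂ}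

/-- The bilinear square in circular coordinates: `u·u = |k|² (x|v| + iy)(x|v| - iy)`.
[cite: KishimotoYoneda2022, §1 Lemma 1.2 (ii)] -/
theorem dot_self_eq_circ (v w : Fin 3 → ℝ) (x y : ℂ) :
    dot (x • cplx ((v ⨯₃ w) ⨯₃ v) + y • cplx (v ⨯₃ w)) (x • cplx ((v ⨯₃ w) ⨯₃ v) + y • cplx (v ⨯₃ w))
      = ((((v ⨯₃ w) ⬝ᵥ (v ⨯₃ w)) : ℝ) : ℂ)
          * ((x * (Real.sqrt (v ⬝ᵥ v) : ℂ) + I * y) * (x * (Real.sqrt (v ⬝ᵥ v) : ℂ) - I * y)) := by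
  rw [dot_self_frame₁]
  have hρ : (0 : ℝ) ≤ v ⬝ᵥ v := by
    rw [real_dot_eq]; nlinarith [sq_nonneg (v 0), sq_nonneg (v 1), sq_nonneg (v 2)]
  have hs : ((Real.sqrt (v ⬝ᵥ v) : ℂ)) ^ 2 = ((v ⬝ᵥ v : ℝ) : ℂ) := by
    rw [← Complex.ofReal_pow, Real.sq_sqrt hρ]
  have hI : I ^ 2 = -1 := Complex.I_sq
  linear_combination ((((v ⨯₃ w) ⬝ᵥ (v ⨯₃ w)) : ℝ) : ℂ) * (- x ^ 2 * hs + y ^ 2 * hI)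

/-- **Prop. 4.4 (iv) / Prop. 4.7, algebraic core, for closed chains of any length.** Let
`v₀, v₁, …` be an `m`-periodic chain of frequencies with consecutive ones linearly independent,
carrying non-zero divergence-free vectors `u_j ⊥ v_j` such that consecutive pairs do not interact
((2.3)). Then either `u₀ · u₀ = 0` (so `u₀` is a Beltrami vector, Lemma 1.2 (ii)), or the product
`W = ∏_{j<m} frameFactor v_j v_{j+1} v_{j+2}` of the frame factors of the `m` vertices
`v₁, …, v_m = v₀` is real: the composed rotation `𝓡₁` of Lemma 4.6 is a rotation by an angle in
`πℤ`. [cite: KishimotoYoneda2022, §4 Lemma 4.6, Prop. 4.4 (iv) (proof), Prop. 4.7 (proof)] -/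
theorem dot_self_eq_zero_or_conj_prod_frameFactor_eq (hv : ∀ j, v (j + m) = v j)
    (hu : ∀ j, u (j + m) = u j) (hk : ∀ j, v j ⨯₃ v (j + 1) ≠ 0) (hne : ∀ j, u j ≠ 0)
    (hdiv : ∀ j, dot (cplx (v j)) (u j) = 0)
    (hNI : ∀ j, NonInteracting (v j) (v (j + 1)) (u j) (u (j + 1))) :
    dot (u 0) (u 0) = 0 ∨
      (starRingEnd ℂ) (∏ j ∈ Finset.range m, frameFactor (v j) (v (j + 1)) (v (j + 2)))
        = ∏ j ∈ Finset.range m, frameFactor (v j) (v (j + 1)) (v (j + 2)) := by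
  classical
  -- outgoing frame coordinates of `u j` at `v j` in the frame `k_j = v j × v (j+1)`
  have hout : ∀ j, ∃ xy : ℂ × ℂ, u j = xy.1 • cplx ((v j ⨯₃ v (j + 1)) ⨯₃ v j)
      + xy.2 • cplx (v j ⨯₃ v (j + 1)) := by
    intro j
    obtain ⟨a, b, h⟩ := exists_frame₁ (hk j) (hdiv j)
    exact ⟨(a, b), h⟩
  choose xy hxy using hout
  -- incoming frame coordinates of `u (j+1)` at `v (j+1)` in the frame `k_j`
  have hin : ∀ j, ∃ xy' : ℂ × ℂ, u (j + 1) = xy'.1 • cplx ((v j ⨯₃ v (j + 1)) ⨯₃ v (j + 1))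
      + xy'.2 • cplx (v j ⨯₃ v (j + 1)) := by
    intro j
    obtain ⟨a, b, h⟩ := exists_frame₂ (hk j) (hdiv (j + 1))
    exact ⟨(a, b), h⟩
  choose xy' hxy' using hin
  -- notation
  set s : ℕ → ℂ := fun j => (Real.sqrt (v j ⬝ᵥ v j) : ℂ) with hs
  set A : ℕ → ℂ := fun j => (xy j).1 * s j + I * (xy j).2 with hA
  set B : ℕ → ℂ := fun j => (xy j).1 * s j - I * (xy j).2 with hB
  set K : ℕ → ℂ := fun j => ((((v j ⨯₃ v (j + 1)) ⬝ᵥ (v j ⨯₃ v (j + 1))) : ℝ) : ℂ) with hK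
  set F : ℕ → ℂ := fun j => frameFactor (v j) (v (j + 1)) (v (j + 2)) with hF
  -- one full step `j → j+1`
  have hstep : ∀ j, ∃ γ : ℂ, γ ≠ 0 ∧ K (j + 1) * A (j + 1) = γ * (starRingEnd ℂ) (F j) * A j ∧
      K (j + 1) * B (j + 1) = γ * F j * B j := by
    intro j
    obtain ⟨γ, hγ, h1, h2⟩ := circ_transport (hk j) (hxy j) (hxy' j) (hne j) (hne (j + 1)) (hNI j)
    have hvq : v (j + 1) ⨯₃ v (j + 1 + 1) ≠ 0 := hk (j + 1)
    obtain ⟨h3, h4⟩ := circ_out_eq (p := v j) hvq (hxy' j) (hxy (j + 1))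
    refine ⟨γ, hγ, ?_, ?_⟩
    · simp only [hK, hA, hF]
      rw [show j + 2 = j + 1 + 1 from rfl, h3, h1]; ring
    · simp only [hK, hB, hF]
      rw [show j + 2 = j + 1 + 1 from rfl, h4, h2]; ring
  choose γ hγ hγA hγB using hstep
  -- induction along the chain
  have hind : ∀ n, (∏ j ∈ Finset.range n, K (j + 1)) * A n
        = (∏ j ∈ Finset.range n, (γ j * (starRingEnd ℂ) (F j))) * A 0 ∧
      (∏ j ∈ Finset.range n, K (j + 1)) * B n
        = (∏ j ∈ Finset.range n, (γ j * F j)) * B 0 := by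
    intro n
    induction n with
    | zero => simp
    | succ n ih =>
      obtain ⟨ihA, ihB⟩ := ih
      rw [Finset.prod_range_succ, Finset.prod_range_succ, Finset.prod_range_succ]
      constructor
      · calc (∏ j ∈ Finset.range n, K (j + 1)) * K (n + 1) * A (n + 1)
            = (∏ j ∈ Finset.range n, K (j + 1)) * (K (n + 1) * A (n + 1)) := by ring
          _ = (∏ j ∈ Finset.range n, K (j + 1)) * (γ n * (starRingEnd ℂ) (F n) * A n) := by
              rw [hγA n]
          _ = γ n * (starRingEnd ℂ) (F n) * ((∏ j ∈ Finset.range n, K (j + 1)) * A n) := by ring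
          _ = _ := by rw [ihA]; ring
      · calc (∏ j ∈ Finset.range n, K (j + 1)) * K (n + 1) * B (n + 1)
            = (∏ j ∈ Finset.range n, K (j + 1)) * (K (n + 1) * B (n + 1)) := by ring
          _ = (∏ j ∈ Finset.range n, K (j + 1)) * (γ n * F n * B n) := by rw [hγB n]
          _ = γ n * F n * ((∏ j ∈ Finset.range n, K (j + 1)) * B n) := by ring
          _ = _ := by rw [ihB]; ring
  -- periodicity: the coordinates at step `m` coincide with those at step `0`
  have hvm : v m = v 0 := by simpa using hv 0
  have hvm1 : v (m + 1) = v 1 := by rw [Nat.add_comm]; exact hv 1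
  have hum : u m = u 0 := by simpa using hu 0
  have hxym : xy m = xy 0 := by
    have h0 := hxy 0
    have hm' := hxy m
    rw [hvm1, hvm, hum, h0] at hm'
    have hk0 : v 0 ⨯₃ v (0 + 1) ≠ 0 := hk 0
    obtain ⟨h1, h2⟩ := (frame_eq_iff₁ hk0 _ _ _ _).1 hm'
    exact (Prod.ext h1 h2).symm
  have hsm : s m = s 0 := by simp only [hs]; rw [hvm]
  have hAm : A m = A 0 := by simp only [hA]; rw [hxym, hsm]
  have hBm : B m = B 0 := by simp only [hB]; rw [hxym, hsm]
  obtain ⟨hmA, hmB⟩ := hind m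
  rw [hAm] at hmA
  rw [hBm] at hmB
  -- the scalar products
  have hKne : (∏ j ∈ Finset.range m, K (j + 1)) ≠ 0 := by
    rw [Finset.prod_ne_zero_iff]
    intro j _
    simp only [hK]
    exact_mod_cast real_dot_self_ne_zero (hk (j + 1))
  have hγne : (∏ j ∈ Finset.range m, γ j) ≠ 0 := Finset.prod_ne_zero_iff.2 fun j _ => hγ j
  by_cases hAB : A 0 = 0 ∨ B 0 = 0
  · left
    rw [hxy 0, dot_self_eq_circ]
    rcases hAB with h | h
    · have : A 0 = 0 := h
      simp only [hA] at this
      rw [this]; ring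
    · have : B 0 = 0 := h
      simp only [hB] at this
      rw [this]; ring
  · right
    simp only [not_or] at hAB
    obtain ⟨hA0, hB0⟩ := hAB
    have e1 : (∏ j ∈ Finset.range m, K (j + 1))
        = ∏ j ∈ Finset.range m, (γ j * (starRingEnd ℂ) (F j)) := mul_right_cancel₀ hA0 hmA
    have e2 : (∏ j ∈ Finset.range m, K (j + 1))
        = ∏ j ∈ Finset.range m, (γ j * F j) := mul_right_cancel₀ hB0 hmB
    rw [Finset.prod_mul_distrib] at e1 e2
    have e3 : (∏ j ∈ Finset.range m, (starRingEnd ℂ) (F j)) = ∏ j ∈ Finset.range m, F j :=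
      mul_left_cancel₀ hγne (e1.symm.trans e2)
    rw [← map_prod] at e3
    exact e3

end Chain

/-! ### Composition of frame factors at a fixed vertex (used for fan triangulations) -/

/-- Real part of the composition rule of frame factors at a common vertex. [folklore] -/
theorem frameFactor_trans_re (a v b c : Fin 3 → ℝ) :
    ((a ⨯₃ v) ⬝ᵥ (v ⨯₃ b)) * ((b ⨯₃ v) ⬝ᵥ (v ⨯₃ c)) - (a ⬝ᵥ (v ⨯₃ b)) * (b ⬝ᵥ (v ⨯₃ c)) * (v ⬝ᵥ v)
      = -((v ⨯₃ b) ⬝ᵥ (v ⨯₃ b)) * ((a ⨯₃ v) ⬝ᵥ (v ⨯₃ c)) := by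
  simp only [real_dot_eq, cross_apply, Matrix.cons_val_zero, Matrix.cons_val_one,
    Matrix.head_cons, Matrix.cons_val_two, Matrix.tail_cons]
  ring

/-- Imaginary part of the composition rule of frame factors at a common vertex. [folklore] -/
theorem frameFactor_trans_im (a v b c : Fin 3 → ℝ) :
    ((a ⨯₃ v) ⬝ᵥ (v ⨯₃ b)) * (b ⬝ᵥ (v ⨯₃ c)) + (a ⬝ᵥ (v ⨯₃ b)) * ((b ⨯₃ v) ⬝ᵥ (v ⨯₃ c))
      = -((v ⨯₃ b) ⬝ᵥ (v ⨯₃ b)) * (a ⬝ᵥ (v ⨯₃ c)) := by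
  simp only [real_dot_eq, cross_apply, Matrix.cons_val_zero, Matrix.cons_val_one,
    Matrix.head_cons, Matrix.cons_val_two, Matrix.tail_cons]
  ring

/-- **Composition of elementary rotations about a fixed vertex.** Passing at `v` from the plane
`(a, v)` to `(v, b)` and then (reading the plane `(v, b)` as `(b, v)`) to `(v, c)` is, up to the
positive factor `|v × b|²` and a sign, passing directly from `(a, v)` to `(v, c)`:
`F(a,v,b) F(b,v,c) = -|v × b|² F(a,v,c)`. This is what makes the rotation `𝓡₁` of a polygon the
composition of the rotations of the triangles of a fan triangulation.
[cite: KishimotoYoneda2022, §4 Lemma 4.6 (proof)] -/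
theorem frameFactor_trans (a v b c : Fin 3 → ℝ) :
    frameFactor a v b * frameFactor b v c
      = -((((v ⨯₃ b) ⬝ᵥ (v ⨯₃ b)) : ℝ) : ℂ) * frameFactor a v c := by
  unfold frameFactor
  have hρ : (0 : ℝ) ≤ v ⬝ᵥ v := by
    rw [real_dot_eq]; nlinarith [sq_nonneg (v 0), sq_nonneg (v 1), sq_nonneg (v 2)]
  have hs : ((Real.sqrt (v ⬝ᵥ v) : ℂ)) ^ 2 = ((v ⬝ᵥ v : ℝ) : ℂ) := by
    rw [← Complex.ofReal_pow, Real.sq_sqrt hρ]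
  have hre := congrArg (fun r : ℝ => (r : ℂ)) (frameFactor_trans_re a v b c)
  have him := congrArg (fun r : ℝ => (r : ℂ)) (frameFactor_trans_im a v b c)
  push_cast at hre him
  linear_combination hre + I * (Real.sqrt (v ⬝ᵥ v) : ℂ) * him
    + ((a ⬝ᵥ (v ⨯₃ b) : ℝ) : ℂ) * ((b ⬝ᵥ (v ⨯₃ c) : ℝ) : ℂ) * I ^ 2 * hs
    + ((a ⬝ᵥ (v ⨯₃ b) : ℝ) : ℂ) * ((b ⬝ᵥ (v ⨯₃ c) : ℝ) : ℂ) * ((v ⬝ᵥ v : ℝ) : ℂ) * Complex.I_sq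

/-- Traversing the vertex in the opposite direction conjugates the frame factor:
`F(b, v, a) = conj F(a, v, b)`. [folklore] -/
theorem frameFactor_swap (a v b : Fin 3 → ℝ) :
    frameFactor b v a = (starRingEnd ℂ) (frameFactor a v b) := by
  rw [conj_frameFactor]
  unfold frameFactor
  have h1 : (b ⨯₃ v) ⬝ᵥ (v ⨯₃ a) = (a ⨯₃ v) ⬝ᵥ (v ⨯₃ b) := by
    simp only [real_dot_eq, cross_apply, Matrix.cons_val_zero, Matrix.cons_val_one,
      Matrix.head_cons, Matrix.cons_val_two, Matrix.tail_cons]; ring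
  have h2 : b ⬝ᵥ (v ⨯₃ a) = -(a ⬝ᵥ (v ⨯₃ b)) := by
    simp only [real_dot_eq, cross_apply, Matrix.cons_val_zero, Matrix.cons_val_one,
      Matrix.head_cons, Matrix.cons_val_two, Matrix.tail_cons]; ring
  rw [h1, h2]; push_cast; ring

end KY

end Literature.Analysis.FluidPDE
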